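import Summits.QuantumFields.BalabanUV.T4Continuum.Support.VariationalColourTaxiTowerAvgGDecay
import Summits.QuantumFields.BalabanUV.T4Continuum.Support.CompositeFibreMismatch

/-!
# T⁴ programme, spine node NE2 (U1a), lane P2 — «V-AVG-G AT TAXI DATA», file 6: CLASS READINGS OF THE TAXI TOWER's FIRST-ORDER QUANTITIES AGAINST THE RATE `θ`
# (`θ² ≥ L⁻¹`) AND THE k-UNIFORM READINGS OF THE TWO-STEP FRAMES' CONSTANTS — the arithmetic both END hosts at taxi data consume (real arithmetic only;
# model level; cell `pub-balaban`)

NE2 formalisation swarm `b2b-balaban-t4-ne2-formalise-*`, leaf prover 10 GEN 5 (`prover-b2b-balaban-t4-ne2-formalise-leaf-10-g5-0`, V-END holder lineage); item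
«V-AVG-G AT TAXI DATA», file 6 (journal NOTE l.22515: the class readings needed by the junction F4 ∘ `hONEm_taxi`, written once for both hosts).  Over file 2b's
`VariationalColourTaxiTowerAvgGDecay.{inv_pow_le_sq, first_order_le}` (p238839), leaf-04-g5's `VariationalColourTaxiTowerEndClass.{sumDefect_le_of_class, levelDefect_le_of_class,
kappaV_inv_le, LambdaV_le_of_class}`, leaf-03-g7's `CompositeFibreMismatch.mismatch_twoStepTaxi_class` and `CovariantBlockReversePoincare.revPC` BY NAME; nothing defined.

CONTENT (level `k`, `n = L^k`, `t = θ^k`, class `(L^k)²a_k ≤ c`, `(L^{k+1})²b_k ≤ c`, `L⁻¹ ≤ θ² ≤ 1`).  §1 the first-order quantities of the (ONE-min) ∕ (G″) suppliers at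
taxi data against `t`: `a_k ≤ c·t⁴`, `L²b_k ≤ c·t⁴`, `(n²)⁻¹ ≤ t⁴`, FED⁺'s mismatch `m_k = (d−1)L(L−1)b_k ≤ (d−1)c·t⁴` and `n·m_k ≤ (d−1)c·t²`, ONE⁺'s `m₁,k =
(d−1)(L−1)(2L−1)b_k ≤ 2(d−1)c·t⁴` and `nL·m₁,k ≤ 2(d−1)Lc·t²`, the two-step frame distance `L(n−1)(L−1)b_k ≤ c·t²`, the scalar one-step `ε₁⁰ = (d∕4+½)L∕n² ≤ (d∕4+½)L·t⁴`,
and `a_k²n² ≤ c²·t⁴`.  §2 the k-uniform readings: `revPC d N x ≤ 4d·36^d(1+y)²` for `N·x ≤ y`; the composite frames' nearness budget `γ_F,k = S_k + 3(d−1)L^k(L^k−1)a_k +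
(d−1)(L^k−1)(2L^k−1)a_k ≤ (2((d−1)+d²) + 5(d−1))·c` and `κᵥ(L^k·L)⁻¹·γ_F,k ≤ 60·6^{d−1}·(2((d−1)+d²) + 5(d−1))·c` (so `hcF` of `hONEm_taxi` and the `½` needed by the supplier's
fine V-UB constant are ONE polynomial smallness line); the supplier's fine V-UB constant `Λᵥ,k ≤ 4·lamV d ((d−1)(3Lc)) d 0` (two-step in-block class `(L^kL)·w_cp ≤ 3(d−1)Lc`).

HONEST FRAMING (T4-DAG p. 1).  Real arithmetic about OUR typed class constants; the thresholds are quantitatively void (memo GF3COV §3); nothing printed is a hypothesis; no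
`def`, no `def … : Prop`, no `sorry`; axioms standard.  NOT an END statement; V-END with background ∕ NE2 NOT proved; NE3 OPEN; spine PROVED 0∕9 unchanged; rung (B)+1 on a
fixed finite T⁴ — NOT infinite volume, NOT mass gap, NOT Clay.  HONEST DEPENDENCY (cell, verbatim): continuum YM on T⁴ ⇐ BetaPertH ∧ nine spine estimates (0/9 proved); BetaPertH
⇐ (D1) ∧ (D4) ∧ CAP+tail; G-an2-4 gates asym, D1 and NE2/3/4.
-/

noncomputable section

namespace Summit.QuantumFields.BalabanUV.T4Continuum.VariationalColourTaxiClassReadings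

open Finset
open Summit.QuantumFields.BalabanUV.T4Continuum.VectorBlockTrialForm (kappaV kappaV_pos)
open Summit.QuantumFields.BalabanUV.T4Continuum.VariationalVectorForm (lamV lamV_nonneg)
open Summit.QuantumFields.BalabanUV.T4Continuum.VariationalColourTaxiTransport (sumDefect_le_of_class levelDefect_le_of_class kappaV_inv_le LambdaV_le_of_class)
open Summit.QuantumFields.BalabanUV.T4Continuum.VariationalColourTaxiTowerAvgGDecay (inv_pow_le_sq first_order_le)
open Summit.QuantumFields.BalabanUV.T4Continuum.CompositeFibreMismatch (mismatch_twoStepTaxi_class)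
open Summit.QuantumFields.BalabanUV.T4Continuum.CovariantBlockReversePoincare (revPC revPC_nonneg)

variable {d : ℕ} (L : ℕ)

/-! ## §1 The first-order quantities at level `k` against `t = θ^k` -/

section FirstOrder

variable {a b c θ : ℝ} {k : ℕ}

/-- `(n²)⁻¹ ≤ t⁴` (`n = L^k`, `L⁻¹ ≤ θ²`). [folklore] -/
theorem inv_sq_le (hL : 1 ≤ L) (hθL : (L : ℝ)⁻¹ ≤ θ ^ 2) (k : ℕ) : ((((L ^ k : ℕ) : ℝ)) ^ 2)⁻¹ ≤ (θ ^ k) ^ 4 := by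
  have h := inv_pow_le_sq L hL hθL k
  have h0 : 0 ≤ (((L ^ k : ℕ) : ℝ))⁻¹ := inv_nonneg.mpr (Nat.cast_nonneg _)
  calc ((((L ^ k : ℕ) : ℝ)) ^ 2)⁻¹ = (((L ^ k : ℕ) : ℝ))⁻¹ * (((L ^ k : ℕ) : ℝ))⁻¹ := by rw [sq, mul_inv]
    _ ≤ (θ ^ k) ^ 2 * (θ ^ k) ^ 2 := mul_le_mul h h h0 (sq_nonneg _)
    _ = (θ ^ k) ^ 4 := by ring

/-- the level plaquette bound itself decays: `a_k ≤ c·t⁴`. [folklore] -/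
theorem a_le (hL : 1 ≤ L) (hθL : (L : ℝ)⁻¹ ≤ θ ^ 2) (ha0 : 0 ≤ a) (hac : (((L ^ k : ℕ)) : ℝ) ^ 2 * a ≤ c) : a ≤ c * (θ ^ k) ^ 4 := by
  have hN1 : (1 : ℝ) ≤ ((L ^ k : ℕ) : ℝ) := by exact_mod_cast Nat.one_le_pow k L hL
  have hN0 : (0 : ℝ) < ((L ^ k : ℕ) : ℝ) ^ 2 := by positivity
  have hc0 : 0 ≤ c := le_trans (by positivity) hac
  have e : a = (((L ^ k : ℕ) : ℝ) ^ 2)⁻¹ * ((((L ^ k : ℕ)) : ℝ) ^ 2 * a) := by field_simp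
  rw [e]
  calc ((((L ^ k : ℕ) : ℝ)) ^ 2)⁻¹ * ((((L ^ k : ℕ)) : ℝ) ^ 2 * a) ≤ ((((L ^ k : ℕ) : ℝ)) ^ 2)⁻¹ * c :=
        mul_le_mul_of_nonneg_left hac (inv_nonneg.mpr hN0.le)
    _ ≤ (θ ^ k) ^ 4 * c := mul_le_mul_of_nonneg_right (inv_sq_le L hL hθL k) hc0
    _ = c * (θ ^ k) ^ 4 := mul_comm _ _

/-- the one-step plaquette bound read at scale `L`: `L²·b_k ≤ c·t⁴`. [folklore] -/
theorem LLb_le (hL : 1 ≤ L) (hθL : (L : ℝ)⁻¹ ≤ θ ^ 2) (hb0 : 0 ≤ b) (hbc : (((L ^ (k + 1) : ℕ)) : ℝ) ^ 2 * b ≤ c) :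
    (L : ℝ) * L * b ≤ c * (θ ^ k) ^ 4 := by
  have hcast : (((L ^ (k + 1) : ℕ)) : ℝ) = ((L ^ k : ℕ) : ℝ) * L := by push_cast; ring
  rw [hcast] at hbc
  have hac' : (((L ^ k : ℕ)) : ℝ) ^ 2 * ((L : ℝ) * L * b) ≤ c := by
    calc (((L ^ k : ℕ)) : ℝ) ^ 2 * ((L : ℝ) * L * b) = (((L ^ k : ℕ) : ℝ) * L) ^ 2 * b := by ring
      _ ≤ c := hbc
  exact a_le L hL hθL (by positivity) hac'

/-- FED⁺'s mismatch size: `m_k = (d−1)L(L−1)b_k ≤ (d−1)c·t⁴`. [folklore] -/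
theorem m_le (hL : 1 ≤ L) (hθL : (L : ℝ)⁻¹ ≤ θ ^ 2) (hb0 : 0 ≤ b) (hbc : (((L ^ (k + 1) : ℕ)) : ℝ) ^ 2 * b ≤ c) :
    ((d - 1 : ℕ) : ℝ) * L * ((L - 1 : ℕ) : ℝ) * b ≤ ((d - 1 : ℕ) : ℝ) * c * (θ ^ k) ^ 4 := by
  have hL0 : (0 : ℝ) ≤ L := Nat.cast_nonneg L
  have hL1r : ((L - 1 : ℕ) : ℝ) ≤ L := by exact_mod_cast Nat.sub_le L 1
  have h1 : (L : ℝ) * ((L - 1 : ℕ) : ℝ) * b ≤ (L : ℝ) * L * b := mul_le_mul_of_nonneg_right (mul_le_mul_of_nonneg_left hL1r hL0) hb0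
  calc ((d - 1 : ℕ) : ℝ) * L * ((L - 1 : ℕ) : ℝ) * b = ((d - 1 : ℕ) : ℝ) * ((L : ℝ) * ((L - 1 : ℕ) : ℝ) * b) := by ring
    _ ≤ ((d - 1 : ℕ) : ℝ) * (c * (θ ^ k) ^ 4) := mul_le_mul_of_nonneg_left (h1.trans (LLb_le L hL hθL hb0 hbc)) (Nat.cast_nonneg _)
    _ = ((d - 1 : ℕ) : ℝ) * c * (θ ^ k) ^ 4 := by ring

/-- `n·m_k ≤ (d−1)c·t²`. [folklore] -/
theorem nm_le (hL : 1 ≤ L) (hθL : (L : ℝ)⁻¹ ≤ θ ^ 2) (ha0 : 0 ≤ a) (hb0 : 0 ≤ b) (hac : (((L ^ k : ℕ)) : ℝ) ^ 2 * a ≤ c)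
    (hbc : (((L ^ (k + 1) : ℕ)) : ℝ) ^ 2 * b ≤ c) :
    ((L ^ k : ℕ) : ℝ) * (((d - 1 : ℕ) : ℝ) * L * ((L - 1 : ℕ) : ℝ) * b) ≤ ((d - 1 : ℕ) : ℝ) * c * (θ ^ k) ^ 2 := by
  have hL0 : (0 : ℝ) ≤ L := Nat.cast_nonneg L
  have hN0 : (0 : ℝ) ≤ ((L ^ k : ℕ) : ℝ) := Nat.cast_nonneg _
  have hL1r : ((L - 1 : ℕ) : ℝ) ≤ L := by exact_mod_cast Nat.sub_le L 1
  have hNLLb := (first_order_le L hL hθL k ha0 hbc hac).1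
  have h1 : (L : ℝ) * ((L - 1 : ℕ) : ℝ) * b ≤ (L : ℝ) * L * b := mul_le_mul_of_nonneg_right (mul_le_mul_of_nonneg_left hL1r hL0) hb0
  calc ((L ^ k : ℕ) : ℝ) * (((d - 1 : ℕ) : ℝ) * L * ((L - 1 : ℕ) : ℝ) * b) = ((d - 1 : ℕ) : ℝ) * (((L ^ k : ℕ) : ℝ) * ((L : ℝ) * ((L - 1 : ℕ) : ℝ) * b)) := by ring
    _ ≤ ((d - 1 : ℕ) : ℝ) * (((L ^ k : ℕ) : ℝ) * ((L : ℝ) * L * b)) := mul_le_mul_of_nonneg_left (mul_le_mul_of_nonneg_left h1 hN0) (Nat.cast_nonneg _)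
    _ ≤ ((d - 1 : ℕ) : ℝ) * (c * (θ ^ k) ^ 2) := mul_le_mul_of_nonneg_left hNLLb (Nat.cast_nonneg _)
    _ = ((d - 1 : ℕ) : ℝ) * c * (θ ^ k) ^ 2 := by ring

/-- ONE⁺'s in-block ∕ crossing size: `m₁,k = (d−1)(L−1)(2L−1)b_k ≤ 2(d−1)c·t⁴`. [folklore] -/
theorem m1_le (hL : 1 ≤ L) (hθL : (L : ℝ)⁻¹ ≤ θ ^ 2) (hb0 : 0 ≤ b) (hbc : (((L ^ (k + 1) : ℕ)) : ℝ) ^ 2 * b ≤ c) :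
    ((d - 1 : ℕ) : ℝ) * ((L - 1 : ℕ) : ℝ) * ((2 * L - 1 : ℕ) : ℝ) * b ≤ 2 * ((d - 1 : ℕ) : ℝ) * c * (θ ^ k) ^ 4 := by
  have hL0 : (0 : ℝ) ≤ L := Nat.cast_nonneg L
  have hL1r : ((L - 1 : ℕ) : ℝ) ≤ L := by exact_mod_cast Nat.sub_le L 1
  have h2L1 : ((2 * L - 1 : ℕ) : ℝ) ≤ 2 * L := by exact_mod_cast Nat.sub_le (2 * L) 1
  have h1 : ((L - 1 : ℕ) : ℝ) * ((2 * L - 1 : ℕ) : ℝ) * b ≤ 2 * ((L : ℝ) * L * b) := by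
    calc ((L - 1 : ℕ) : ℝ) * ((2 * L - 1 : ℕ) : ℝ) * b ≤ (L : ℝ) * (2 * L) * b :=
          mul_le_mul_of_nonneg_right (mul_le_mul hL1r h2L1 (Nat.cast_nonneg _) hL0) hb0
      _ = 2 * ((L : ℝ) * L * b) := by ring
  calc ((d - 1 : ℕ) : ℝ) * ((L - 1 : ℕ) : ℝ) * ((2 * L - 1 : ℕ) : ℝ) * b = ((d - 1 : ℕ) : ℝ) * (((L - 1 : ℕ) : ℝ) * ((2 * L - 1 : ℕ) : ℝ) * b) := by ring
    _ ≤ ((d - 1 : ℕ) : ℝ) * (2 * (c * (θ ^ k) ^ 4)) :=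
        mul_le_mul_of_nonneg_left (h1.trans (mul_le_mul_of_nonneg_left (LLb_le L hL hθL hb0 hbc) (by norm_num))) (Nat.cast_nonneg _)
    _ = 2 * ((d - 1 : ℕ) : ℝ) * c * (θ ^ k) ^ 4 := by ring

/-- `n·L·m₁,k ≤ 2(d−1)Lc·t²`. [folklore] -/
theorem nLm1_le (hL : 1 ≤ L) (hθL : (L : ℝ)⁻¹ ≤ θ ^ 2) (ha0 : 0 ≤ a) (hb0 : 0 ≤ b) (hac : (((L ^ k : ℕ)) : ℝ) ^ 2 * a ≤ c)
    (hbc : (((L ^ (k + 1) : ℕ)) : ℝ) ^ 2 * b ≤ c) :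
    ((L ^ k : ℕ) : ℝ) * L * (((d - 1 : ℕ) : ℝ) * ((L - 1 : ℕ) : ℝ) * ((2 * L - 1 : ℕ) : ℝ) * b) ≤ 2 * ((d - 1 : ℕ) : ℝ) * L * c * (θ ^ k) ^ 2 := by
  have hL0 : (0 : ℝ) ≤ L := Nat.cast_nonneg L
  have hN0 : (0 : ℝ) ≤ ((L ^ k : ℕ) : ℝ) := Nat.cast_nonneg _
  have hL1r : ((L - 1 : ℕ) : ℝ) ≤ L := by exact_mod_cast Nat.sub_le L 1
  have h2L1 : ((2 * L - 1 : ℕ) : ℝ) ≤ 2 * L := by exact_mod_cast Nat.sub_le (2 * L) 1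
  have hNLLb := (first_order_le L hL hθL k ha0 hbc hac).1
  have h1 : ((d - 1 : ℕ) : ℝ) * ((L - 1 : ℕ) : ℝ) * ((2 * L - 1 : ℕ) : ℝ) * b ≤ ((d - 1 : ℕ) : ℝ) * (L * (2 * L)) * b := by
    apply mul_le_mul_of_nonneg_right _ hb0
    rw [mul_assoc ((d - 1 : ℕ) : ℝ)]
    exact mul_le_mul_of_nonneg_left (mul_le_mul hL1r h2L1 (Nat.cast_nonneg _) hL0) (Nat.cast_nonneg _)
  calc ((L ^ k : ℕ) : ℝ) * L * (((d - 1 : ℕ) : ℝ) * ((L - 1 : ℕ) : ℝ) * ((2 * L - 1 : ℕ) : ℝ) * b)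
      ≤ ((L ^ k : ℕ) : ℝ) * L * (((d - 1 : ℕ) : ℝ) * (L * (2 * L)) * b) := mul_le_mul_of_nonneg_left h1 (by positivity)
    _ = 2 * ((d - 1 : ℕ) : ℝ) * L * (((L ^ k : ℕ) : ℝ) * ((L : ℝ) * L * b)) := by ring
    _ ≤ 2 * ((d - 1 : ℕ) : ℝ) * L * (c * (θ ^ k) ^ 2) := mul_le_mul_of_nonneg_left hNLLb (by positivity)
    _ = 2 * ((d - 1 : ℕ) : ℝ) * L * c * (θ ^ k) ^ 2 := by ring

/-- the two-step ∕ straight-taxi frame distance: `L(n−1)(L−1)b_k ≤ c·t²`. [folklore] -/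
theorem frameDist_le (hL : 1 ≤ L) (hθL : (L : ℝ)⁻¹ ≤ θ ^ 2) (ha0 : 0 ≤ a) (hb0 : 0 ≤ b) (hac : (((L ^ k : ℕ)) : ℝ) ^ 2 * a ≤ c)
    (hbc : (((L ^ (k + 1) : ℕ)) : ℝ) ^ 2 * b ≤ c) :
    (L : ℝ) * ((L ^ k - 1 : ℕ) : ℝ) * ((L - 1 : ℕ) : ℝ) * b ≤ c * (θ ^ k) ^ 2 := by
  have hL0 : (0 : ℝ) ≤ L := Nat.cast_nonneg L
  have hL1r : ((L - 1 : ℕ) : ℝ) ≤ L := by exact_mod_cast Nat.sub_le L 1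
  have hn1r : ((L ^ k - 1 : ℕ) : ℝ) ≤ ((L ^ k : ℕ) : ℝ) := by exact_mod_cast Nat.sub_le (L ^ k) 1
  have hNLLb := (first_order_le L hL hθL k ha0 hbc hac).1
  have h2 : (L : ℝ) * ((L ^ k - 1 : ℕ) : ℝ) ≤ (L : ℝ) * ((L ^ k : ℕ) : ℝ) := mul_le_mul_of_nonneg_left hn1r hL0
  calc (L : ℝ) * ((L ^ k - 1 : ℕ) : ℝ) * ((L - 1 : ℕ) : ℝ) * b ≤ (L : ℝ) * ((L ^ k : ℕ) : ℝ) * L * b := by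
        apply mul_le_mul_of_nonneg_right _ hb0
        exact mul_le_mul h2 hL1r (Nat.cast_nonneg _) (by positivity)
    _ = ((L ^ k : ℕ) : ℝ) * ((L : ℝ) * L * b) := by ring
    _ ≤ c * (θ ^ k) ^ 2 := hNLLb

/-- the scalar one-step defect of the harmonic approximation: `ε₁⁰ = (d∕4+½)·L∕n² ≤ (d∕4+½)L·t⁴`. [folklore] -/
theorem eps10_le (hL : 1 ≤ L) (hθL : (L : ℝ)⁻¹ ≤ θ ^ 2) (k : ℕ) :
    ((d : ℝ) / 4 + 1 / 2) * ((L : ℝ) / ((L ^ k : ℕ) : ℝ) ^ 2) ≤ ((d : ℝ) / 4 + 1 / 2) * L * (θ ^ k) ^ 4 := by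
  have hL0 : (0 : ℝ) ≤ L := Nat.cast_nonneg L
  have h1 : (L : ℝ) / ((L ^ k : ℕ) : ℝ) ^ 2 ≤ L * (θ ^ k) ^ 4 := by
    rw [div_eq_mul_inv]
    exact mul_le_mul_of_nonneg_left (inv_sq_le L hL hθL k) hL0
  calc ((d : ℝ) / 4 + 1 / 2) * ((L : ℝ) / ((L ^ k : ℕ) : ℝ) ^ 2) ≤ ((d : ℝ) / 4 + 1 / 2) * (L * (θ ^ k) ^ 4) := mul_le_mul_of_nonneg_left h1 (by positivity)
    _ = ((d : ℝ) / 4 + 1 / 2) * L * (θ ^ k) ^ 4 := by ring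

/-- `a_k²·n² ≤ c²·t⁴`. [folklore] -/
theorem asq_nsq_le (hL : 1 ≤ L) (hθL : (L : ℝ)⁻¹ ≤ θ ^ 2) (ha0 : 0 ≤ a) (hac : (((L ^ k : ℕ)) : ℝ) ^ 2 * a ≤ c) :
    a ^ 2 * (((L ^ k : ℕ)) : ℝ) ^ 2 ≤ c ^ 2 * (θ ^ k) ^ 4 := by
  have hc0 : 0 ≤ c := le_trans (by positivity) hac
  have h1 := a_le L hL hθL ha0 hac
  calc a ^ 2 * (((L ^ k : ℕ)) : ℝ) ^ 2 = ((((L ^ k : ℕ)) : ℝ) ^ 2 * a) * a := by ring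
    _ ≤ c * (c * (θ ^ k) ^ 4) := mul_le_mul hac h1 ha0 hc0
    _ = c ^ 2 * (θ ^ k) ^ 4 := by ring

end FirstOrder

/-! ## §2 The k-uniform readings -/

section Uniform

/-- the reverse-Poincaré constant is monotone in its mismatch class: `0 ≤ x`, `N·x ≤ y` ⟹ `revPC d N x ≤ 4d·36^d(1+y)²`. [folklore] -/
theorem revPC_le_of_mul_le {N : ℕ} {x y : ℝ} (hx : 0 ≤ x) (hy : (N : ℝ) * x ≤ y) : revPC d N x ≤ 4 * d * (36 : ℝ) ^ d * (1 + y) ^ 2 := by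
  unfold revPC
  have h0 : 0 ≤ 1 + (N : ℝ) * x := by positivity
  exact mul_le_mul_of_nonneg_left (pow_le_pow_left₀ h0 (by linarith) 2) (by positivity)

/-- **THE COMPOSITE FRAMES' NEARNESS BUDGET IS k-UNIFORM UNDER THE CLASS**: `γ_F,k = S_k + 3(d−1)L^k(L^k−1)a_k + (d−1)(L^k−1)(2L^k−1)a_k ≤ (2((d−1)+d²) + 5(d−1))·c`. [folklore] -/
theorem gammaF_le_of_class (hL : 2 ≤ L) {a b : ℕ → ℝ} {c : ℝ} (ha0 : ∀ k, 0 ≤ a k) (hb0 : ∀ k, 0 ≤ b k)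
    (hac : ∀ k, (((L ^ k : ℕ)) : ℝ) ^ 2 * a k ≤ c) (hbc : ∀ k, (((L ^ (k + 1) : ℕ)) : ℝ) ^ 2 * b k ≤ c) (k : ℕ) :
    (∑ q ∈ Finset.range k, ((((d - 1 : ℕ) : ℝ) + (d : ℝ) * d) * (((L : ℝ) * ((L ^ q - 1 : ℕ) : ℝ) * ((L - 1 : ℕ) : ℝ)) * b q)))
        + 3 * (((d - 1 : ℕ) : ℝ) * (L ^ k : ℕ) * ((L ^ k - 1 : ℕ) : ℝ) * a k) + ((d - 1 : ℕ) : ℝ) * ((L ^ k - 1 : ℕ) : ℝ) * ((2 * L ^ k - 1 : ℕ) : ℝ) * a k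
      ≤ (2 * ((((d - 1 : ℕ) : ℝ)) + (d : ℝ) * d) + 5 * ((d - 1 : ℕ) : ℝ)) * c := by
  have hS := sumDefect_le_of_class (d := d) L hL hb0 hbc k
  have hT := levelDefect_le_of_class (d := d) L k (ha0 k) (hac k)
  have hn1r : ((L ^ k - 1 : ℕ) : ℝ) ≤ ((L ^ k : ℕ) : ℝ) := by exact_mod_cast Nat.sub_le (L ^ k) 1
  have h2n1 : ((2 * L ^ k - 1 : ℕ) : ℝ) ≤ 2 * ((L ^ k : ℕ) : ℝ) := by exact_mod_cast Nat.sub_le (2 * L ^ k) 1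
  have hak := ha0 k
  have hD0 : (0 : ℝ) ≤ ((d - 1 : ℕ) : ℝ) := Nat.cast_nonneg _
  have hU : ((d - 1 : ℕ) : ℝ) * ((L ^ k - 1 : ℕ) : ℝ) * ((2 * L ^ k - 1 : ℕ) : ℝ) * a k ≤ 2 * (((d - 1 : ℕ) : ℝ) * c) := by
    calc ((d - 1 : ℕ) : ℝ) * ((L ^ k - 1 : ℕ) : ℝ) * ((2 * L ^ k - 1 : ℕ) : ℝ) * a k
        = ((d - 1 : ℕ) : ℝ) * (((L ^ k - 1 : ℕ) : ℝ) * ((2 * L ^ k - 1 : ℕ) : ℝ) * a k) := by ring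
      _ ≤ ((d - 1 : ℕ) : ℝ) * (((L ^ k : ℕ) : ℝ) * (2 * ((L ^ k : ℕ) : ℝ)) * a k) :=
          mul_le_mul_of_nonneg_left (mul_le_mul_of_nonneg_right (mul_le_mul hn1r h2n1 (Nat.cast_nonneg _) (Nat.cast_nonneg _)) hak) hD0
      _ = 2 * (((d - 1 : ℕ) : ℝ) * ((((L ^ k : ℕ)) : ℝ) ^ 2 * a k)) := by ring
      _ ≤ 2 * (((d - 1 : ℕ) : ℝ) * c) := mul_le_mul_of_nonneg_left (mul_le_mul_of_nonneg_left (hac k) hD0) (by norm_num)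
  calc (∑ q ∈ Finset.range k, ((((d - 1 : ℕ) : ℝ) + (d : ℝ) * d) * (((L : ℝ) * ((L ^ q - 1 : ℕ) : ℝ) * ((L - 1 : ℕ) : ℝ)) * b q)))
          + 3 * (((d - 1 : ℕ) : ℝ) * (L ^ k : ℕ) * ((L ^ k - 1 : ℕ) : ℝ) * a k) + ((d - 1 : ℕ) : ℝ) * ((L ^ k - 1 : ℕ) : ℝ) * ((2 * L ^ k - 1 : ℕ) : ℝ) * a k
      ≤ 2 * ((((d - 1 : ℕ) : ℝ) + (d : ℝ) * d) * c) + 3 * (((d - 1 : ℕ) : ℝ) * c) + 2 * (((d - 1 : ℕ) : ℝ) * c) := add_le_add (add_le_add hS hT) hU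
    _ = (2 * ((((d - 1 : ℕ) : ℝ)) + (d : ℝ) * d) + 5 * ((d - 1 : ℕ) : ℝ)) * c := by ring

/-- **`hcF` UNDER THE CLASS**: `κᵥ(L^k·L)⁻¹·γ_F,k ≤ 60·6^{d−1}·(2((d−1)+d²) + 5(d−1))·c` (`1 ≤ d`, `2 ≤ L`). [folklore] -/
theorem kappa_gammaF_le_of_class (hL : 2 ≤ L) (hd : 1 ≤ d) {a b : ℕ → ℝ} {c : ℝ} (ha0 : ∀ k, 0 ≤ a k) (hb0 : ∀ k, 0 ≤ b k)
    (hac : ∀ k, (((L ^ k : ℕ)) : ℝ) ^ 2 * a k ≤ c) (hbc : ∀ k, (((L ^ (k + 1) : ℕ)) : ℝ) ^ 2 * b k ≤ c) (k : ℕ) :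
    (kappaV d (L ^ k * L))⁻¹ * ((∑ q ∈ Finset.range k, ((((d - 1 : ℕ) : ℝ) + (d : ℝ) * d) * (((L : ℝ) * ((L ^ q - 1 : ℕ) : ℝ) * ((L - 1 : ℕ) : ℝ)) * b q)))
        + 3 * (((d - 1 : ℕ) : ℝ) * (L ^ k : ℕ) * ((L ^ k - 1 : ℕ) : ℝ) * a k) + ((d - 1 : ℕ) : ℝ) * ((L ^ k - 1 : ℕ) : ℝ) * ((2 * L ^ k - 1 : ℕ) : ℝ) * a k)
      ≤ 60 * (6 : ℝ) ^ (d - 1) * ((2 * ((((d - 1 : ℕ) : ℝ)) + (d : ℝ) * d) + 5 * ((d - 1 : ℕ) : ℝ)) * c) := by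
  have hpos : 0 < L ^ k * L := Nat.mul_pos (pow_pos (by omega) k) (by omega)
  have hκ := kappaV_inv_le (d := d) hd hpos
  have hγ := gammaF_le_of_class (d := d) L hL ha0 hb0 hac hbc k
  have hγ0 : 0 ≤ (∑ q ∈ Finset.range k, ((((d - 1 : ℕ) : ℝ) + (d : ℝ) * d) * (((L : ℝ) * ((L ^ q - 1 : ℕ) : ℝ) * ((L - 1 : ℕ) : ℝ)) * b q)))
        + 3 * (((d - 1 : ℕ) : ℝ) * (L ^ k : ℕ) * ((L ^ k - 1 : ℕ) : ℝ) * a k) + ((d - 1 : ℕ) : ℝ) * ((L ^ k - 1 : ℕ) : ℝ) * ((2 * L ^ k - 1 : ℕ) : ℝ) * a k := by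
    have := ha0 k
    have hs : 0 ≤ ∑ q ∈ Finset.range k, ((((d - 1 : ℕ) : ℝ) + (d : ℝ) * d) * (((L : ℝ) * ((L ^ q - 1 : ℕ) : ℝ) * ((L - 1 : ℕ) : ℝ)) * b q)) :=
      Finset.sum_nonneg fun q _ => by have := hb0 q; positivity
    positivity
  exact mul_le_mul hκ hγ hγ0 (by positivity)

/-- **THE SUPPLIER's FINE V-UB CONSTANT IS k-UNIFORM**: with the two-step in-block class `(L^kL)·w_cp ≤ 3(d−1)Lc` (`mismatch_twoStepTaxi_class`) and `κ⁻¹γ_F ≤ ½`,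
`lamV d ((L^kL)·w_cp) d ((L^kL)²·0) ∕ (1 − κ⁻¹γ_F)² ≤ 4·lamV d ((d−1)(3Lc)) d 0`. [folklore] -/
theorem LambdaF_le_of_class (hL : 1 ≤ L) (k : ℕ) {a b c t : ℝ} (ha0 : 0 ≤ a) (hb0 : 0 ≤ b)
    (hac : (((L ^ k : ℕ)) : ℝ) ^ 2 * a ≤ c) (hbc : (((L ^ k * L : ℕ)) : ℝ) ^ 2 * b ≤ c) (ht : t ≤ 1 / 2) :
    lamV d ((L ^ k * L : ℕ) * (((d - 1 : ℕ) : ℝ) * ((L - 1 : ℕ) : ℝ) * ((2 * L - 1 : ℕ) : ℝ) * b + ((d - 1 : ℕ) : ℝ) * ((L ^ k - 1 : ℕ) : ℝ) * a)) (d : ℝ)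
        ((((L ^ k * L : ℕ)) : ℝ) ^ 2 * 0) / (1 - t) ^ 2
      ≤ 4 * lamV d (((d - 1 : ℕ) : ℝ) * (3 * L * c)) (d : ℝ) 0 := by
  have hw := mismatch_twoStepTaxi_class (d := d) L k hL hb0 ha0 hbc hac
  have hx0 : 0 ≤ ((L ^ k * L : ℕ) : ℝ) * (((d - 1 : ℕ) : ℝ) * ((L - 1 : ℕ) : ℝ) * ((2 * L - 1 : ℕ) : ℝ) * b + ((d - 1 : ℕ) : ℝ) * ((L ^ k - 1 : ℕ) : ℝ) * a) := by
    positivity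
  have hx : ((L ^ k * L : ℕ) : ℝ) * (((d - 1 : ℕ) : ℝ) * ((L - 1 : ℕ) : ℝ) * ((2 * L - 1 : ℕ) : ℝ) * b + ((d - 1 : ℕ) : ℝ) * ((L ^ k - 1 : ℕ) : ℝ) * a)
      ≤ ((d - 1 : ℕ) : ℝ) * (3 * L * c) := hw.trans (le_of_eq (by ring))
  exact LambdaV_le_of_class (d := d) (CG := (d : ℝ)) (CGs := (d : ℝ)) hx0 hx (Nat.cast_nonneg d) le_rfl (le_of_eq (mul_zero _).symm) (le_of_eq (mul_zero _)) ht

end Uniform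

end Summit.QuantumFields.BalabanUV.T4Continuum.VariationalColourTaxiClassReadings

end
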